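import Summits.BirchSwinnertonDyer.BirchSwinnertonDyer.Theorems.SmallImageMuTransferMuTransferX9OfStepsTwoFourOdd
import Summits.BirchSwinnertonDyer.BirchSwinnertonDyer.Theorems.SmallImageMuTransferMuTransferX9KolyvaginPackage
import Summits.BirchSwinnertonDyer.Rank1Residual.GaloisImage.PropagatedConditionCardEP
import HarnessLib

/-!
# Item `MuTransferX9Core` of route `SmallImageMuTransfer` (stmt-BirchSwinnertonDyer-19842) — CLOSED:
# Kato's μ-transfer on class X9 (the deciding crux `MuTransferX9`, stmt-BirchSwinnertonDyer-19276)
# modulo EXACTLY its three unproved published named facts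

Cell `bsd-smallim`, seat `bsd-smallim-k6-c2` (gen 4, the line lead and final landing hand).  HONEST FRAMING:
one closing theorem, no definition, no named fact, no `sorry`; nothing is asserted about any curve; this
closes a rung-K6 support item of `BirchSwinnertonDyer` («closes rung K6's conditional core»), never summit
credit, and it does NOT prove BSD.  The deciding crux `MuTransferX9` (19276) stays OPEN by design (its
statement is unconditional); its open surface after this file = the three named facts below (items
19843/19844/19845, by-name aliases; F2 = `Kato2004.mem_pSmul_of_red_eq_zero` in progress at k6-g4 g2).

`MuTransferX9Core` (route rev 17, plan g11 D2b) :=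
`Kato2004.exists_divisibilityInputs_fineQuotient_zeta →` (F1: Kato 2004 Thm. 12.5/12.6 package with the fine
quotient (14.9.3)/(17.13.1) and the zeta span clause) `Kato2004.mem_pSmul_of_red_eq_zero →` (F2: Kato §13.8,
kernel of reduction mod `p` on `𝐇¹`) `GaloisCohomology.poitouTate_sum_localTatePairing_eq_zero ℚ →` (F3:
Poitou–Tate over `ℚ`, Milne ADT I 4.10) `<MuTransferX9 VERBATIM>` (for every X9 pair `(E, p)`, newform `f`
with one `p`-adic unit coefficient of `L_p(f, α, T)`, every cyclotomic `(κ, γ)` and every Selmer dual datum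
`D`: `μ(D) = 0`).

Proof = the kernel composition `Theorems.smallImageMuTransfer_MuTransferX9_of_stepsTwoFourOdd` (k6-c2 g4,
p470966: GV Prop. 3.7 → certificate ⟹ `L_p ∉ pΛ` → §6 (i) a GENUINE Euler-system class `s ∉ p𝐇¹` → the core
`CoreAssembly.stub_coreX9_of_selmerDualOdd_of_stepsTwoFourOdd` (k6-c2 g3, p452034) → `Sel₀[p]` finite →
`X₀/pX₀` finite → `μ = 0`) fed with the two tree theorems that discharge the remaining inputs of skeleton v6d
(100eb8c6a7ccf73b): Tate's local Euler–Poincaré characteristic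
`GaloisImage.EP.forall_localEulerPoincareCharacteristic_adicCompletion ℚ` and THE REGISTERED OPEN STUB
`stub_stepsTwoFourOdd`, now the theorem `TameClass.stub_stepsTwoFourOdd_holds` (koly g9, p474398 — the
Kolyvagin package at one `E`-split tame prime: G3a tame class koly p468725/p469552/p470496/p471863, Lemma 2 +
value x10 p469014, hfix x9 p471231, division k6-g3 p451789, Euler factor mod `p` lur-a p468436, STEP 4 koly
p457656 + x10 p454438, pair transport x9 p455870, assembly lur-b p472462; the Selmer-side stub
`SelmerDual.stub_selmerDualOdd_holds` k6-c2 g3 p465845 with lur-a/lur-b/k6-g4/k6-ty/x9 inputs).  `MuTransferX9`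
unfolds by `δ` inside `MuTransferX9Core`, so the composition's type IS the item's body after `intro`.
PARTITION (D-0054): X9 (A4; good-ordinary `p ∈ {5,7}`, `ρ̄` irreducible ∧ ¬surjective) — closes the support
item 19842 (the conditional core of rung K6's deciding crux); the crux 19276 itself = F1 ∧ F2 ∧ F3 away.

References: K. Kato, Astérisque 295 (2004) Thm. 12.5, 12.6, Ex. 13.3, §13.8, (14.9.3), §17.13
[Kato2004Asterisque]; B. Mazur, K. Rubin, Mem. AMS 799 (2004) Prop. 1.3.2, §4.4, §5.3 [MazurRubin2004];
J. S. Milne, *Arithmetic Duality Theorems* (2006) I 2.8, I 4.10 [MilneADT2006]; R. Greenberg, V. Vatsal,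
Invent. Math. 142 (2000) Prop. 3.7 [GreenbergVatsal2000]; K. Rubin, *Euler Systems* (2000) §4.4 [Rubin2000];
HOME/koly/MU-TRANSFER-PROOF.md §§0–6 (Theorem A, Cor. B), KOLY-MEMO v1.8 Thm. 5.7.1 / Cor. 5.7.2.
-/

-- the summit and its single problem are both named `BirchSwinnertonDyer` (registry layout D-0017)
set_option linter.dupNamespace false
set_option autoImplicit false

namespace Summit.BirchSwinnertonDyer.BirchSwinnertonDyer.Theorems

/-- **Item `MuTransferX9Core` (stmt-BirchSwinnertonDyer-19842), literally the route decl — PROVED.**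
Kato's μ-transfer on class X9 (KOLY-MEMO Thm. 5.7.1 / Cor. 5.7.2, MU-TRANSFER-PROOF Theorem A + Cor. B: a
`p`-adic unit coefficient of `L_p(f, α, T)` forces `μ(X(E/ℚ_∞)) = 0`, at good ordinary irreducible
NON-surjective `p ∈ {5, 7}`, no Mazur–Rubin `τ`, no surjectivity) modulo exactly the three unproved published
named facts F1 (Kato Thm. 12.5/12.6 package), F2 (Kato §13.8), F3 (Poitou–Tate over `ℚ`), taken as the
item's own hypotheses.  `:= fun hfineZ hred hPT ↦ smallImageMuTransfer_MuTransferX9_of_stepsTwoFourOdd hfineZ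
hred hPT (EP.forall_localEulerPoincareCharacteristic_adicCompletion ℚ) TameClass.stub_stepsTwoFourOdd_holds`.
[cite: Kato2004Asterisque, Thm. 12.5, Thm. 12.6, §13.8, (14.9.3), §17.13] [cite: MazurRubin2004, Prop. 1.3.2, §4.4, §5.3]
[cite: MilneADT2006, Ch. I, Thm. 2.8 and Thm. 4.10] [cite: GreenbergVatsal2000, Prop. 3.7] -/
theorem smallImageMuTransfer_MuTransferX9Core_proof :
    Summit.BirchSwinnertonDyer.BirchSwinnertonDyer.Theses.SmallImageMuTransfer.MuTransferX9Core := by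
  unfold Summit.BirchSwinnertonDyer.BirchSwinnertonDyer.Theses.SmallImageMuTransfer.MuTransferX9Core
  intro hfineZ hred hPT
  exact smallImageMuTransfer_MuTransferX9_of_stepsTwoFourOdd hfineZ hred hPT
    (Summit.BirchSwinnertonDyer.Rank1Residual.GaloisImage.EP.forall_localEulerPoincareCharacteristic_adicCompletion
      ℚ)
    Summit.BirchSwinnertonDyer.BirchSwinnertonDyer.Rank1Residual.TameClass.stub_stepsTwoFourOdd_holds

end Summit.BirchSwinnertonDyer.BirchSwinnertonDyer.Theorems
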